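import Literature.MathematicalPhysics.QuantumFieldTheory.Balaban1983to89.B9LettersZQstarFieldsAtPinsR
import Literature.MathematicalPhysics.QuantumFieldTheory.Balaban1983to89.B9LettersZCFieldsAtPinsB
import Literature.MathematicalPhysics.QuantumFieldTheory.Balaban1983to89.B9BackgroundsKLevelV1R
import Literature.MathematicalPhysics.QuantumFieldTheory.Balaban1983to89.Node00.OpsYRecordV4P
import Literature.MathematicalPhysics.QuantumFieldTheory.Balaban1983to89.B9LettersZSchemasMono
import Literature.MathematicalPhysics.QuantumFieldTheory.Balaban1983to89.B9Thm312WholeHZ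
import Literature.MathematicalPhysics.QuantumFieldTheory.Balaban1983to89.B9LettersHZAtOne

/-!
# BalabanUVNodes ∕ N06 ([B9], `Dag.B9_main`) — THE DERIVED Z-LETTERS OF ROWS 20–21 AT THE CERTIFICATE's PINS, IN ONE LEG: `Q : 𝔠⁽ᵖ⁾ → 𝔠_Z⁽ᵖ⁾` (p = 2, 1) from the pin of `Q`;
# `G₀Q\*`, `∇_UG₀Q\*` from the G₀ layer and the pin of `Q\*`; the (3.132) letters `(QGQ\*)⁻¹`, `(QG₁Q\*)⁻¹` (p = 2 and p = 1) from ROW 26 as the certificate holds it and the pins of `C ∕ C₁`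
# — member-uniformly above ONE produced threshold, with ONE produced constant, the displayed rate δ12₃ for the first four and ROW 26's produced rate `δC` for the last three

Track A of `YM-PLAN.md` (cell `pub-ymgap`, HUMAN RULING D-0062), node **N06** = [Balaban1985BackgroundPropagators] Thms 3.1–3.15; bundle F7 rows 20–21, seat `pub-ymgap-dag-n06-l`
(g30), programme P-DISP 3 «(3.132) ONCE» (memo `DISPLAY-LEDGER-ROWS2021.md` §2).  A HELPER for the rows-20∕21 face v1.5 `…N06Thm312313AtPinsStateSUC` (which `obtain`s from this
leg and runs the two leaves at master rates chosen after `δC`), hence for dag-n06-d's certificate editions after ED.77 «UD».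
WHY.  ED.77 displays among rows 20–21's letters: `hZ8` (gD2 gQs2 gQs1 rgd2 c1_2 c1_1 q2 q1 at B12₃ δ12₃) and `hlettersH12 : LettersHZ …` (gQs2 dgQs c2 c12 at B12₃ δ12₃).  Of these,
`q2 q1` are kinematic (the pin of `Q`, dag-n06-w5's `B9QLettersAtPins.hasMaj_Q_of_pins`), `gQs2 dgQs` follow from the certificate's DERIVED G₀ layer (`(hmodel12 …).1 : Thm33G0 … B12₀ δ12₀`,
`he1G`) and the pin of `Q\*` (w5's lemmas, carrier-generic twins `B9LettersZQstarFieldsAtPinsR`), and `c2 c12 c1_2 c1_1` ARE (3.132) — which the certificate DERIVES as `s3132`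
(`B9Eq3132FromStateR`), at a PRODUCED rate; `B9LettersZCFieldsAtPinsB.c_letters_of_row26B` turns that statement into these class letters at the pins.  THIS FILE packages the three
derivations in the certificate's binder shapes (its `M12 ∕ a12 ∕ c`-prefix, its weight `n⁻¹`, its pins `hblk12 hblkZ12 hQco12 hQsco12 hCco12 hC1co12`), member-uniformly:
★★★ `zletters_of_pins` — ∃ `Mz ≥ M12`, `0 < aC ≤ a12`, `0 < δC`, `Bz ≥ B12₃` such that every member with `Mz ≤ M`, `0 < α₀`, `M·α₀ ≤ aC`, `U` in the carrier's two classes carries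
the seven letters and, packaged, the row-20 record `LettersHZ … Bz (min δ12₃ δC)` (statement below); §2 `scaled_rates` — the pure-real
bookkeeping that scales the leaves' master rates by `λ := min 1 (δC ∕ (ρ12 + 2σ12))`.  Inputs beyond pins and numerics: `hG0e` (Thm33G0 at B12₀ δ12₀), `he1` (the (3.42)₁ homogeneous majorant of ∇_UG₀), `h26` (ROW 26 in the
`ν`-reading the certificate holds — its `s3132` BY DEFEQ); the two (2.60) numerics `hM12q ∕ hB12₃q` of face v1.4; `0 < σ12` (a [4] (2.61) row sum at rate σ12 is obtained inside).
HONEST FRAMING.  By-name composition of kernel-checked helper files; the G₀-layer letters and row 26's statement are HYPOTHESES (the node's content); COUNT-NEUTRAL; nothing of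
[B9]'s propagator estimates asserted; N06 NOT discharged; K1 NOT closed; one finite 𝕋⁴ programme at fixed `ε` — NOT continuum, NOT OS, NOT the mass gap ∕ Clay.  0 `def`, 0 `sorry`.
-/

noncomputable section

namespace Summit.QuantumFields.YangMills.BalabanUVNodes.N06ZLettersLegAtPinsPU

open scoped Matrix.Norms.L2Operator
open Literature.MathematicalPhysics.QuantumFieldTheory.Balaban1983to89
open Literature.MathematicalPhysics.QuantumFieldTheory.Balaban1983to89.Node00
open Literature.MathematicalPhysics.QuantumFieldTheory.Balaban1983to89.B9PinMembersKLevelV1 (MemberY geo9Y bg9Y)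
open Literature.MathematicalPhysics.QuantumFieldTheory.Balaban1983to89.B9BackgroundsKLevelV1R (RegFamY bg9YR MemOfFam mem_of_reg335R)
open Literature.MathematicalPhysics.QuantumFieldTheory.Balaban1983to89.B7Prop2SpecialUnitary (specialUnitaryUnits specialUnitaryUnits_le_U1)
open Literature.MathematicalPhysics.QuantumFieldTheory.Balaban1983to89.B6GlobalChartV1 (blkV1)
open Literature.MathematicalPhysics.QuantumFieldTheory.Balaban1983to89.B6Ineq2142KLevelV1 (β lvl)
open Literature.MathematicalPhysics.QuantumFieldTheory.Balaban1983to89.B6Geom246MultiLevelTorus (geomT)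
open Literature.MathematicalPhysics.QuantumFieldTheory.Balaban1983to89.B6RandomWalkHom (HasMajorantHom)
open Literature.MathematicalPhysics.QuantumFieldTheory.Balaban1983to89.B9CoReadingCoordsTranspose (TrIdx trBasis)
open Literature.MathematicalPhysics.QuantumFieldTheory.Balaban1983to89.B9CoReadingCoords (XBK blkBK)
open Literature.MathematicalPhysics.QuantumFieldTheory.Balaban1983to89.B9CoReadingCoordsH (XHK blkHK)
open Literature.MathematicalPhysics.QuantumFieldTheory.Balaban1983to89.B9GeoNormsKLevelV1 (geo9K geo9K_dist_nonneg)
open Literature.MathematicalPhysics.QuantumFieldTheory.Balaban1983to89.B9GeoLemma21KLevelV1 (geo9Y_dist_triangle geo9Y_dist_comm geo9Y_len_pos rowSum261_geo9Y)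
open Literature.MathematicalPhysics.QuantumFieldTheory.Balaban1983to89.B9Thm34Ext (toB6)
open Literature.MathematicalPhysics.QuantumFieldTheory.Balaban1983to89.B9SectDSup (weightNorm)
open Literature.MathematicalPhysics.QuantumFieldTheory.Balaban1983to89.B11SectG (HasMaj BlockNorm RowSum)
open Literature.MathematicalPhysics.QuantumFieldTheory.Balaban1983to89.B9Thm312Whole (Ops GeoOK cNorm Thm33G0)
open Literature.MathematicalPhysics.QuantumFieldTheory.Balaban1983to89.B9Thm312WholeHZ (LettersHZ)
open Literature.MathematicalPhysics.QuantumFieldTheory.Balaban1983to89.B9LettersHZAtOne (plateau_pos)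
open Literature.MathematicalPhysics.QuantumFieldTheory.Balaban1983to89.Node00.OpsYSectDCoords (QcoKH QscoKH CcoK C1coK)
open Literature.MathematicalPhysics.QuantumFieldTheory.Balaban1983to89.B9Eq3132SectDLetters (QGQinvY)
open Literature.MathematicalPhysics.QuantumFieldTheory.Balaban1983to89.B9Eq3132NuReading (siteKernelOfOpNu nuY)
open Literature.MathematicalPhysics.QuantumFieldTheory.Balaban1983to89.B9LettersZSchemasMono (kernel_mono)
open Literature.MathematicalPhysics.QuantumFieldTheory.Balaban1983to89.B9QLettersAtPins (hasMaj_Q_of_pins)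
open Literature.MathematicalPhysics.QuantumFieldTheory.Balaban1983to89.B9LettersZQstarFieldsAtPinsR (gQs2_pinsB dgQs_pinsB)
open Literature.MathematicalPhysics.QuantumFieldTheory.Balaban1983to89.B9LettersZCFieldsAtPinsB (c_letters_of_row26B)

variable {N : ℕ}

/-- ★★★ **THE DERIVED Z-LETTERS OF ROWS 20–21 AT THE PINS, MemberY θ.d₆ θ.ℓ₆ θ.hd' θ.hL' θ.b₀ θ.b₁ MstarBER-UNIFORMLY** (module docstring): from the pins of `Q ∕ Q\* ∕ C ∕ C₁` and the block maps, the G₀ layer's sup letter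
(`hG0e`) and (3.42)₁ homogeneous majorant (`he1`), ROW 26 as the certificate holds it (`h26`), the (2.60) numerics `hM12q ∕ hB12₃q` and a rate `0 < σ12`, ONE `obtain` gives
`Mz ≥ M12`, `0 < aC ≤ a12`, `0 < δC`, `Bz ≥ B12₃` and, above them, the letters `q2 q1` (at δ12₃), `gQs2 dgQs` (at δ12₃), `c2 c12` (p = 2) and `c1_1` (p = 1) (at δC), all with the
constant `Bz` and the certificate's weight `n⁻¹`.
[cite: Balaban1985BackgroundPropagators, Thm 3.12 pp.421–423, Thm 3.13 p.426, (3.132) p.422, (3.126) p.420, (3.42)–(3.43) pp.397–398, (3.12)–(3.14) p.393, p.398 (remark after (3.47)); Balaban1984PropagatorsII, (2.51)–(2.56) pp.232–233, Lemma 2.1 (2.60)–(2.61) p.234] -/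
theorem zletters_of_pins (θ : Stage3Params) (Mstar : ℕ) (𝔯 : ResY N θ Mstar) {R₁ R₂ : RegFamY θ.d₆ θ.ℓ₆ θ.hd' θ.hL' θ.b₀ θ.b₁ Mstar (Matrix (Fin N) (Fin N) ℂ)} {c : ℝ}
    (hGR : MemOfFam (specialUnitaryUnits (Fin N)) R₁)
    [∀ x : MemberY θ.d₆ θ.ℓ₆ θ.hd' θ.hL' θ.b₀ θ.b₁ Mstar, Fintype (geo9Y x).Site]
    (bI : ∀ x : MemberY θ.d₆ θ.ℓ₆ θ.hd' θ.hL' θ.b₀ θ.b₁ Mstar, FBondY x.toKIdx → IBondY x.toKIdx)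
    (hβ1 : ∀ (x : MemberY θ.d₆ θ.ℓ₆ θ.hd' θ.hL' θ.b₀ θ.b₁ Mstar) (f : FBondY x.toKIdx), (geomT x.D).dist (β x.hN x.D x.hk (bI x f)) (blkV1 x.hN x.D f) ≤ 1)
    (H12 : MemberY θ.d₆ θ.ℓ₆ θ.hd' θ.hL' θ.b₀ θ.b₁ Mstar → Prop) {W12 : MemberY θ.d₆ θ.ℓ₆ θ.hd' θ.hL' θ.b₀ θ.b₁ Mstar → Type} [∀ x, Fintype (W12 x)]
    (𝔬12 : ∀ x : MemberY θ.d₆ θ.ℓ₆ θ.hd' θ.hL' θ.b₀ θ.b₁ Mstar, B9Thm312Whole.Ops (geo9Y x) (bg9YR (Matrix (Fin N) (Fin N) ℂ) (specialUnitaryUnits (Fin N)) R₁ R₂ x) (XBK (TrIdx N) x.toKIdx) (XBK (TrIdx N) x.toKIdx) (XHK (TrIdx N) x.toKIdx) (W12 x))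
    (hblk12 : ∀ x : MemberY θ.d₆ θ.ℓ₆ θ.hd' θ.hL' θ.b₀ θ.b₁ Mstar, (𝔬12 x).blk = blkBK x.toKIdx (bI x)) (hblkZ12 : ∀ x : MemberY θ.d₆ θ.ℓ₆ θ.hd' θ.hL' θ.b₀ θ.b₁ Mstar, (𝔬12 x).blkZ = blkHK x.toKIdx)
    (hQco12 : ∀ (x : MemberY θ.d₆ θ.ℓ₆ θ.hd' θ.hL' θ.b₀ θ.b₁ Mstar) (U : (bg9YR (Matrix (Fin N) (Fin N) ℂ) (specialUnitaryUnits (Fin N)) R₁ R₂ x).Cfg), (𝔬12 x).Q U = QcoKH x.toKIdx (trBasis N) (bg9YR (Matrix (Fin N) (Fin N) ℂ) (specialUnitaryUnits (Fin N)) R₁ R₂ x) (fun U => U) (parBY x.toKIdx) U)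
    (hQsco12 : ∀ (x : MemberY θ.d₆ θ.ℓ₆ θ.hd' θ.hL' θ.b₀ θ.b₁ Mstar) (U : (bg9YR (Matrix (Fin N) (Fin N) ℂ) (specialUnitaryUnits (Fin N)) R₁ R₂ x).Cfg), (𝔬12 x).Qstar U = QscoKH x.toKIdx (trBasis N) (bg9YR (Matrix (Fin N) (Fin N) ℂ) (specialUnitaryUnits (Fin N)) R₁ R₂ x) (fun U => U) (parBY x.toKIdx) U)
    (hCco12 : ∀ (x : MemberY θ.d₆ θ.ℓ₆ θ.hd' θ.hL' θ.b₀ θ.b₁ Mstar) (U : (bg9YR (Matrix (Fin N) (Fin N) ℂ) (specialUnitaryUnits (Fin N)) R₁ R₂ x).Cfg), (𝔬12 x).C U = CcoK x.toKIdx (trBasis N) (bg9YR (Matrix (Fin N) (Fin N) ℂ) (specialUnitaryUnits (Fin N)) R₁ R₂ x) (fun U => U) (parSymY x.toKIdx) (parBY x.toKIdx) (GpPhysY x.toKIdx (parSymY x.toKIdx)) U)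
    (hC1co12 : ∀ (x : MemberY θ.d₆ θ.ℓ₆ θ.hd' θ.hL' θ.b₀ θ.b₁ Mstar) (U : (bg9YR (Matrix (Fin N) (Fin N) ℂ) (specialUnitaryUnits (Fin N)) R₁ R₂ x).Cfg), (𝔬12 x).C1 U = C1coK x.toKIdx (trBasis N) (bg9YR (Matrix (Fin N) (Fin N) ℂ) (specialUnitaryUnits (Fin N)) R₁ R₂ x) (fun U => U) (parSymY x.toKIdx) (parBY x.toKIdx) (GpPhysY x.toKIdx (parSymY x.toKIdx)) (𝔯 x).Δ2 U)
    {M12 a12 B12₀ B12₃ δ12₀ δ12₃ σ12 : ℝ} (ha12 : 0 < a12) (hB12₀ : 0 ≤ B12₀) (hB12₃ : 0 ≤ B12₃) (hσ12 : 0 < σ12) (hδ30 : 0 < δ12₃) (hδ₃₀ : δ12₃ ≤ δ12₀)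
    (hM12q : (2 : ℝ) * Real.log (((θ.ℓ₆ + 1 : ℕ) : ℝ)) ≤ δ12₃ * (2 * ((θ.ℓ₆ : ℝ) + 1) ^ 2 - 1) * M12)
    (hB12₃q : (((θ.ℓ₆ + 1 : ℕ) : ℝ)) ^ 2 * Real.exp (2 * δ12₃ * ((θ.ℓ₆ : ℝ) + 4)) ≤ B12₃)
    (hG0e : ∀ x : MemberY θ.d₆ θ.ℓ₆ θ.hd' θ.hL' θ.b₀ θ.b₁ Mstar, M12 ≤ (geo9Y x).M → ∀ α₀ : ℝ, 0 < α₀ → (geo9Y x).M * α₀ ≤ a12 → ∀ U : (bg9YR (Matrix (Fin N) (Fin N) ℂ) (specialUnitaryUnits (Fin N)) R₁ R₂ x).Cfg, (bg9YR (Matrix (Fin N) (Fin N) ℂ) (specialUnitaryUnits (Fin N)) R₁ R₂ x).Reg335 c α₀ U →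
      (bg9YR (Matrix (Fin N) (Fin N) ℂ) (specialUnitaryUnits (Fin N)) R₁ R₂ x).Reg336 c α₀ U → Thm33G0 (𝔬12 x) 1 (H12 x) B12₀ δ12₀ U)
    (he1 : ∀ x : MemberY θ.d₆ θ.ℓ₆ θ.hd' θ.hL' θ.b₀ θ.b₁ Mstar, M12 ≤ (geo9Y x).M → ∀ α₀ : ℝ, 0 < α₀ → (geo9Y x).M * α₀ ≤ a12 → ∀ U : (bg9YR (Matrix (Fin N) (Fin N) ℂ) (specialUnitaryUnits (Fin N)) R₁ R₂ x).Cfg, (bg9YR (Matrix (Fin N) (Fin N) ℂ) (specialUnitaryUnits (Fin N)) R₁ R₂ x).Reg335 c α₀ U →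
      (bg9YR (Matrix (Fin N) (Fin N) ℂ) (specialUnitaryUnits (Fin N)) R₁ R₂ x).Reg336 c α₀ U → HasMajorantHom (g := toB6 (geo9Y x) 1 (H12 x)) (𝔬12 x).blk (𝔬12 x).blkY ((𝔬12 x).D U ∘ₗ (𝔬12 x).G0 U) (fun (a b : (geo9Y x).Site) => B12₀ * (geo9Y x).len a * Real.exp (-(δ12₀ * (geo9Y x).dist a b))))
    (h26 : B9.Stmt3132Printed (θ.d₆ + 1) c (geo9Y (d := θ.d₆) (ℓ := θ.ℓ₆) (hd := θ.hd') (hL := θ.hL') (b₀ := θ.b₀) (b₁ := θ.b₁) (Mstar := Mstar))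
      (fun x => bg9YR (Matrix (Fin N) (Fin N) ℂ) (specialUnitaryUnits (Fin N)) R₁ R₂ x)
      (fun x => siteKernelOfOpNu x.toKIdx (bg9YR (Matrix (Fin N) (Fin N) ℂ) (specialUnitaryUnits (Fin N)) R₁ R₂ x) (fun U => U) (nuY (θ.d₆ + 1) x.toKIdx) (QGQinvY x.toKIdx (parSymY x.toKIdx) (parBY x.toKIdx) (GpPhysY x.toKIdx (parSymY x.toKIdx))))
      (fun x => siteKernelOfOpNu x.toKIdx (bg9YR (Matrix (Fin N) (Fin N) ℂ) (specialUnitaryUnits (Fin N)) R₁ R₂ x) (fun U => U) (nuY (θ.d₆ + 1) x.toKIdx) (QG1QinvY x.toKIdx (parSymY x.toKIdx) (parBY x.toKIdx) (GpPhysY x.toKIdx (parSymY x.toKIdx)) (𝔯 x).Δ2))) :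
    ∃ Mz aC δC Bz : ℝ, M12 ≤ Mz ∧ 0 < aC ∧ aC ≤ a12 ∧ 0 < δC ∧ B12₃ ≤ Bz ∧
      ∀ x : MemberY θ.d₆ θ.ℓ₆ θ.hd' θ.hL' θ.b₀ θ.b₁ Mstar, Mz ≤ (geo9Y x).M → ∀ α₀ : ℝ, 0 < α₀ → (geo9Y x).M * α₀ ≤ aC → ∀ U : (bg9YR (Matrix (Fin N) (Fin N) ℂ) (specialUnitaryUnits (Fin N)) R₁ R₂ x).Cfg, (bg9YR (Matrix (Fin N) (Fin N) ℂ) (specialUnitaryUnits (Fin N)) R₁ R₂ x).Reg335 c α₀ U → (bg9YR (Matrix (Fin N) (Fin N) ℂ) (specialUnitaryUnits (Fin N)) R₁ R₂ x).Reg336 c α₀ U →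
        (∀ p : ℕ, p ≤ 2 → HasMaj (cNorm 1 (H12 x) (𝔬12 x).blk (fun y => (geo9Y_len_pos x y).le) p) (cNorm 1 (H12 x) (𝔬12 x).blkZ (fun y => (geo9Y_len_pos x y).le) p) ((𝔬12 x).Q U) (fun a b => Bz * Real.exp (-(δ12₃ * (geo9Y x).dist a b)))) ∧
        HasMaj (weightNorm (BlockNorm.ofBlocks (toB6 (geo9Y x) 1 (H12 x)) (𝔬12 x).blkZ) (fun y => ((((θ.ℓ₆ + 1 : ℕ) : ℝ) ^ (θ.d₆ + 1)) ^ lvl x.hN x.D x.hk y)⁻¹) (fun y => (plateau_pos x.toKIdx y).le)) (cNorm 1 (H12 x) (𝔬12 x).blk (fun y => (geo9Y_len_pos x y).le) 2) ((𝔬12 x).G0 U ∘ₗ (𝔬12 x).Qstar U) (fun a b => Bz * Real.exp (-(δ12₃ * (geo9Y x).dist a b))) ∧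
        HasMaj (weightNorm (BlockNorm.ofBlocks (toB6 (geo9Y x) 1 (H12 x)) (𝔬12 x).blkZ) (fun y => ((((θ.ℓ₆ + 1 : ℕ) : ℝ) ^ (θ.d₆ + 1)) ^ lvl x.hN x.D x.hk y)⁻¹) (fun y => (plateau_pos x.toKIdx y).le)) (cNorm 1 (H12 x) (𝔬12 x).blkY (fun y => (geo9Y_len_pos x y).le) 1) ((𝔬12 x).D U ∘ₗ (𝔬12 x).G0 U ∘ₗ (𝔬12 x).Qstar U) (fun a b => Bz * Real.exp (-(δ12₃ * (geo9Y x).dist a b))) ∧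
        HasMaj (cNorm 1 (H12 x) (𝔬12 x).blkZ (fun y => (geo9Y_len_pos x y).le) 2) (weightNorm (BlockNorm.ofBlocks (toB6 (geo9Y x) 1 (H12 x)) (𝔬12 x).blkZ) (fun y => ((((θ.ℓ₆ + 1 : ℕ) : ℝ) ^ (θ.d₆ + 1)) ^ lvl x.hN x.D x.hk y)⁻¹) (fun y => (plateau_pos x.toKIdx y).le)) ((𝔬12 x).C U) (fun a b => Bz * Real.exp (-(δC * (geo9Y x).dist a b))) ∧
        HasMaj (cNorm 1 (H12 x) (𝔬12 x).blkZ (fun y => (geo9Y_len_pos x y).le) 2) (weightNorm (BlockNorm.ofBlocks (toB6 (geo9Y x) 1 (H12 x)) (𝔬12 x).blkZ) (fun y => ((((θ.ℓ₆ + 1 : ℕ) : ℝ) ^ (θ.d₆ + 1)) ^ lvl x.hN x.D x.hk y)⁻¹) (fun y => (plateau_pos x.toKIdx y).le)) ((𝔬12 x).C1 U) (fun a b => Bz * Real.exp (-(δC * (geo9Y x).dist a b))) ∧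
        HasMaj (cNorm 1 (H12 x) (𝔬12 x).blkZ (fun y => (geo9Y_len_pos x y).le) 1) (weightNorm (BlockNorm.ofBlocks (toB6 (geo9Y x) 1 (H12 x)) (𝔬12 x).blkZ) (fun y => (geo9Y x).len y * ((((θ.ℓ₆ + 1 : ℕ) : ℝ) ^ (θ.d₆ + 1)) ^ lvl x.hN x.D x.hk y)⁻¹) (fun y => (mul_pos (geo9Y_len_pos x y) (plateau_pos x.toKIdx y)).le)) ((𝔬12 x).C1 U) (fun a b => Bz * Real.exp (-(δC * (geo9Y x).dist a b))) ∧
        LettersHZ (𝔬12 x) 1 (H12 x) ⟨geo9Y_dist_triangle x, geo9Y_dist_comm x, geo9K_dist_nonneg x.toKIdx, geo9Y_len_pos x⟩ (weightNorm (BlockNorm.ofBlocks (toB6 (geo9Y x) 1 (H12 x)) (𝔬12 x).blkZ) (fun y => ((((θ.ℓ₆ + 1 : ℕ) : ℝ) ^ (θ.d₆ + 1)) ^ lvl x.hN x.D x.hk y)⁻¹) (fun y => (plateau_pos x.toKIdx y).le)) Bz (min δ12₃ δC) U := by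
  have hgeoOK : ∀ x : MemberY θ.d₆ θ.ℓ₆ θ.hd' θ.hL' θ.b₀ θ.b₁ Mstar, GeoOK (geo9Y x) := fun x => ⟨geo9Y_dist_triangle x, geo9Y_dist_comm x, geo9K_dist_nonneg x.toKIdx, geo9Y_len_pos x⟩
  have hL1 : (1 : ℝ) ≤ ((θ.ℓ₆ + 1 : ℕ) : ℝ) := by exact_mod_cast Nat.succ_le_succ (Nat.zero_le _)
  -- ROW 26 ⟹ the three (3.132) class letters with produced (M₄, δC, a₀C, BC)
  obtain ⟨M₄, δC, a₀C, BC, hM₄, hδC, ha₀C, hBC, hCfam⟩ := c_letters_of_row26B (fun x => (bg9YR (Matrix (Fin N) (Fin N) ℂ) (specialUnitaryUnits (Fin N)) R₁ R₂ x)) (fun x => fun U => U) (fun x => (𝔯 x).Δ2) 𝔬12 H12 hblkZ12 hCco12 hC1co12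
    (fun x y => (plateau_pos x.toKIdx y).le) (fun x y => (mul_pos (geo9Y_len_pos x y) (plateau_pos x.toKIdx y)).le) h26
  -- a [4] (2.61) row sum at rate σ12 for the G₀Q* compositions
  obtain ⟨ML, cL, hrowL⟩ := rowSum261_geo9Y (d := θ.d₆) (ℓ := θ.ℓ₆) (hd := θ.hd') (hL := θ.hL') (b₀ := θ.b₀) (b₁ := θ.b₁) (Mstar := Mstar) σ12 hσ12
  have hrow : ∀ x : MemberY θ.d₆ θ.ℓ₆ θ.hd' θ.hL' θ.b₀ θ.b₁ Mstar, ML ≤ (geo9Y x).M → RowSum (toB6 (geo9Y x) 1 (H12 x)) σ12 (max cL 0) := fun x hM y => (hrowL x hM y).trans (le_max_left _ _)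
  set BQ : ℝ := B12₀ * Real.exp ((δ12₃ + σ12) * ((θ.ℓ₆ : ℝ) + 4)) * max cL 0 with hBQd
  set Bz : ℝ := max (max B12₃ BQ) BC with hBzd
  have hB3z : B12₃ ≤ Bz := (le_max_left _ _).trans (le_max_left _ _)
  have hBQz : BQ ≤ Bz := (le_max_right _ _).trans (le_max_left _ _)
  have hBCz : BC ≤ Bz := le_max_right _ _
  refine ⟨max M12 (max ML M₄), min a12 a₀C, δC, Bz, le_max_left _ _, lt_min ha12 ha₀C, min_le_left _ _, hδC, hB3z, fun x hM α₀ hα ha U hU hU' => ?_⟩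
  have hM12x : M12 ≤ (geo9Y x).M := (le_max_left _ _).trans hM
  have hMLx : ML ≤ (geo9Y x).M := ((le_max_left _ _).trans (le_max_right _ _)).trans hM
  have hM4x : M₄ ≤ (geo9Y x).M := ((le_max_right _ _).trans (le_max_right _ _)).trans hM
  have ha12x : (geo9Y x).M * α₀ ≤ a12 := ha.trans (min_le_left _ _)
  have haCx : (geo9Y x).M * α₀ ≤ a₀C := ha.trans (min_le_right _ _)
  have hUG := mem_of_reg335R hGR x hU
  have ks : ∀ a b : (geo9Y x).Site, B12₃ * Real.exp (-(δ12₃ * (geo9Y x).dist a b)) ≤ Bz * Real.exp (-(δ12₃ * (geo9Y x).dist a b)) :=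
    fun a b => kernel_mono (hgeoOK x) hB12₃ hB3z (le_refl δ12₃) a b
  have kC : ∀ a b : (geo9Y x).Site, BC * Real.exp (-(δC * (geo9Y x).dist a b)) ≤ Bz * Real.exp (-(δC * (geo9Y x).dist a b)) :=
    fun a b => kernel_mono (hgeoOK x) hBC.le hBCz (le_refl δC) a b
  -- the letters of Q from the pin (face v1.4's `hq`, verbatim)
  have hq : ∀ p : ℕ, p ≤ 2 → HasMaj (cNorm 1 (H12 x) (𝔬12 x).blk (fun y => (geo9Y_len_pos x y).le) p) (cNorm 1 (H12 x) (𝔬12 x).blkZ (fun y => (geo9Y_len_pos x y).le) p) ((𝔬12 x).Q U) (fun a b => B12₃ * Real.exp (-(δ12₃ * (geo9Y x).dist a b))) := by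
    intro p hp
    letI : Fintype (B9GeoNormsKLevelV1.geo9K x.toKIdx).Site := (inferInstance : Fintype (geo9Y x).Site)
    have hpar : ∀ s s', ‖(parBY x.toKIdx U s s' : Matrix (Fin N) (Fin N) ℂ)‖ ≤ 1 ∧
        ‖(((parBY x.toKIdx U s s')⁻¹ : (Matrix (Fin N) (Fin N) ℂ)ˣ) : Matrix (Fin N) (Fin N) ℂ)‖ ≤ 1 := by
      intro s s'; rcases isEmpty_or_nonempty (Fin N) with hN | hN
      · have h0 : ∀ A : Matrix (Fin N) (Fin N) ℂ, ‖A‖ ≤ 1 := fun A => by rw [Subsingleton.elim A 0, norm_zero]; exact zero_le_one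
        exact ⟨h0 _, h0 _⟩
      · exact specialUnitaryUnits_le_U1 (parBY_mem x.toKIdx (G := specialUnitaryUnits (Fin N)) hUG s s')
    have hL2 : (1 : ℝ) ≤ 2 * ((θ.ℓ₆ : ℝ) + 1) ^ 2 - 1 := by nlinarith [sq_nonneg (θ.ℓ₆ : ℝ), Nat.cast_nonneg (α := ℝ) θ.ℓ₆]
    have hthr : (p : ℝ) * Real.log (B9GeoNormsKLevelV1.geo9K x.toKIdx).L ≤ δ12₃ * (2 * ((θ.ℓ₆ : ℝ) + 1) ^ 2 - 1) * (B9GeoNormsKLevelV1.geo9K x.toKIdx).M :=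
      calc (p : ℝ) * Real.log (B9GeoNormsKLevelV1.geo9K x.toKIdx).L ≤ 2 * Real.log (((θ.ℓ₆ + 1 : ℕ) : ℝ)) := mul_le_mul_of_nonneg_right (by exact_mod_cast hp) (Real.log_nonneg hL1)
        _ ≤ δ12₃ * (2 * ((θ.ℓ₆ : ℝ) + 1) ^ 2 - 1) * M12 := hM12q
        _ ≤ δ12₃ * (2 * ((θ.ℓ₆ : ℝ) + 1) ^ 2 - 1) * (geo9Y x).M := mul_le_mul_of_nonneg_left hM12x (mul_nonneg hδ30.le (by linarith))
    have h := hasMaj_Q_of_pins x.toKIdx (trBasis N) (bg9YR (Matrix (Fin N) (Fin N) ℂ) (specialUnitaryUnits (Fin N)) R₁ R₂ x) (fun U => U) (parBY x.toKIdx)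
      (hgeoOK x) (𝔬12 x) (hblk12 x) (hblkZ12 x) (hQco12 x U) (hβ1 x) hpar hδ30 p hthr (R₀ := (1 : ℝ)) (H₀ := H12 x)
    have hLp : (B9GeoNormsKLevelV1.geo9K x.toKIdx).L ^ p ≤ (((θ.ℓ₆ + 1 : ℕ) : ℝ)) ^ 2 := pow_le_pow_right₀ hL1 hp
    exact h.mono fun a b => mul_le_mul_of_nonneg_right ((mul_le_mul_of_nonneg_right hLp (Real.exp_nonneg _)).trans hB12₃q) (Real.exp_nonneg _)
  -- G₀Q* and ∇_UG₀Q* from the G₀ layer and the pin of Q* (constant BQ ≤ Bz, rate δ12₃: δQ := δ12₃ + σ12 is free)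
  have hσQ : (0 : ℝ) ≤ δ12₃ + σ12 := by linarith
  have hgQs2 := gQs2_pinsB x (hβ1 x) (B := (bg9YR (Matrix (Fin N) (Fin N) ℂ) (specialUnitaryUnits (Fin N)) R₁ R₂ x)) (cfg := fun U => U) (𝔬 := 𝔬12 x) (H := H12 x) (B₀ := B12₀) (δ₀ := δ12₀) (σ := σ12) (c := max cL 0) (δ₃ := δ12₃)
    (δQ := δ12₃ + σ12) (B₃ := Bz) (U := U) hUG (hrow x hMLx) (le_max_right _ _) hB12₀ hσQ hδ30.le hδ₃₀ le_rfl hBQz (hblk12 x) (hblkZ12 x) (hQsco12 x U)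
    (hG0e x hM12x α₀ hα ha12x U hU hU').e0 (fun y => (plateau_pos x.toKIdx y).le)
  have hdgQs := dgQs_pinsB x (hβ1 x) (B := (bg9YR (Matrix (Fin N) (Fin N) ℂ) (specialUnitaryUnits (Fin N)) R₁ R₂ x)) (cfg := fun U => U) (𝔬 := 𝔬12 x) (H := H12 x) (B₀ := B12₀) (δ₀ := δ12₀) (σ := σ12) (c := max cL 0) (δ₃ := δ12₃)
    (δQ := δ12₃ + σ12) (B₃ := Bz) (U := U) hUG (hrow x hMLx) (le_max_right _ _) hB12₀ hσQ hδ30.le hδ₃₀ le_rfl hBQz (hblk12 x) (hblkZ12 x) (hQsco12 x U)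
    (he1 x hM12x α₀ hα ha12x U hU hU') (fun y => (plateau_pos x.toKIdx y).le)
  have hC := hCfam x hM4x α₀ hα haCx U hU hU'
  have hBz0 : 0 ≤ Bz := hB12₃.trans hB3z
  have kH : ∀ a b : (geo9Y x).Site, Bz * Real.exp (-(δ12₃ * (geo9Y x).dist a b)) ≤ Bz * Real.exp (-(min δ12₃ δC * (geo9Y x).dist a b)) :=
    fun a b => kernel_mono (hgeoOK x) hBz0 (le_refl Bz) (min_le_left δ12₃ δC) a b
  have kCH : ∀ a b : (geo9Y x).Site, BC * Real.exp (-(δC * (geo9Y x).dist a b)) ≤ Bz * Real.exp (-(min δ12₃ δC * (geo9Y x).dist a b)) :=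
    fun a b => kernel_mono (hgeoOK x) hBC.le hBCz (min_le_right δ12₃ δC) a b
  exact ⟨fun p hp => (hq p hp).mono ks, hgQs2, hdgQs, hC.1.mono kC, hC.2.1.mono kC, hC.2.2.mono kC,
    ⟨hgQs2.mono kH, hdgQs.mono kH, hC.1.mono kCH, hC.2.1.mono kCH⟩⟩

/-- ★ **THE LEAVES' MASTER RATES, SCALED AFTER ROW 26's PRODUCED RATE** (pure real bookkeeping): with `λ := min 1 (δC ∕ (ρ12 + 2σ12))` the rates `ρ⋆ = λρ12`, `σ⋆ = λσ12`,
`ρf⋆ = λρf12`, `ρ′⋆ = λρ13` satisfy every budget of the rows-20∕21 leaves that the displayed rates satisfy (those are homogeneous in (ρ, σ, ρf, ρ′) or upper bounds by fixed rates),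
and in addition `ρ⋆ + 2σ⋆ ≤ δC`. [cite: Balaban1985BackgroundPropagators, Thm 3.12 p.423 («a common, best possible, decay rate δ₀»: the conclusion's rate is existential), bookkeeping] -/
theorem scaled_rates {ρ12 σ12 ρf12 ρ13 α12 δ12₀ δK12 δP δ12₃ δC : ℝ} (hσ12 : 0 < σ12) (hρ12 : 0 < ρ12) (hρf12 : 0 < ρf12) (hρ13 : 0 < ρ13)
    (hρS12 : ρ12 ≤ δ12₀) (hρδ12 : ρ12 + 2 * σ12 ≤ δK12) (hρP12 : ρ12 + 2 * σ12 ≤ δP) (hδP₃ : δP ≤ δ12₃)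
    (hρf1 : ρf12 + σ12 ≤ (1 - α12) * ρ12) (hρf2 : ρf12 + 2 * σ12 + α12 * ρ12 ≤ ρ12) (hρ13ρ : ρ13 + 5 * σ12 ≤ ρ12) (hσρ13 : 3 * σ12 < (1 - α12) * ρ13)
    (hδC : 0 < δC) :
    ∃ ρs σs ρfs ρ13s : ℝ, 0 < σs ∧ 0 < ρs ∧ 0 < ρfs ∧ 0 < ρ13s ∧ ρs ≤ δ12₀ ∧ ρs + 2 * σs ≤ δK12 ∧ ρs + 2 * σs ≤ δP ∧ ρs ≤ δ12₃ ∧ ρs ≤ δC ∧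
      ρfs + σs ≤ (1 - α12) * ρs ∧ ρfs + 2 * σs + α12 * ρs ≤ ρs ∧ ρ13s + 5 * σs ≤ ρs ∧ ρ13s + 3 * σs ≤ ρs ∧ 3 * σs < (1 - α12) * ρ13s ∧
      ρs + 2 * σs ≤ min δ12₃ δC := by
  have hden : 0 < ρ12 + 2 * σ12 := by linarith
  set lam : ℝ := min 1 (δC / (ρ12 + 2 * σ12)) with hlam
  have hlam0 : 0 < lam := lt_min one_pos (div_pos hδC hden)
  have hlam1 : lam ≤ 1 := min_le_left _ _
  have hlamC : lam * (ρ12 + 2 * σ12) ≤ δC :=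
    calc lam * (ρ12 + 2 * σ12) ≤ δC / (ρ12 + 2 * σ12) * (ρ12 + 2 * σ12) := mul_le_mul_of_nonneg_right (min_le_right _ _) hden.le
      _ = δC := div_mul_cancel₀ δC hden.ne'
  have hle1 : ∀ {t : ℝ}, 0 ≤ t → lam * t ≤ t := fun {t} ht => by simpa only [one_mul] using mul_le_mul_of_nonneg_right hlam1 ht
  have hσs : 0 < lam * σ12 := mul_pos hlam0 hσ12
  have h2 : lam * (ρ12 + 2 * σ12) ≤ ρ12 + 2 * σ12 := hle1 hden.le
  have h1 : lam * (ρ12 + σ12) ≤ ρ12 + σ12 := hle1 (by linarith)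
  have h0 : lam * ρ12 ≤ ρ12 := hle1 hρ12.le
  have e2 : lam * ρ12 + 2 * (lam * σ12) = lam * (ρ12 + 2 * σ12) := by ring
  have e1 : lam * ρ12 + lam * σ12 = lam * (ρ12 + σ12) := by ring
  have h2' : lam * ρ12 + 2 * (lam * σ12) ≤ ρ12 + 2 * σ12 := by rw [e2]; exact h2
  have h1' : lam * ρ12 + lam * σ12 ≤ ρ12 + σ12 := by rw [e1]; exact h1
  have hC' : lam * ρ12 + 2 * (lam * σ12) ≤ δC := by rw [e2]; exact hlamC
  refine ⟨lam * ρ12, lam * σ12, lam * ρf12, lam * ρ13, hσs, mul_pos hlam0 hρ12, mul_pos hlam0 hρf12, mul_pos hlam0 hρ13, h0.trans hρS12,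
    h2'.trans hρδ12, h2'.trans hρP12, by linarith [hσs, h2', hρP12, hδP₃], by linarith [hσs, hC'], ?_, ?_, ?_, ?_, ?_, le_min (h2'.trans (hρP12.trans hδP₃)) hC'⟩
  · calc lam * ρf12 + lam * σ12 = lam * (ρf12 + σ12) := by ring
      _ ≤ lam * ((1 - α12) * ρ12) := mul_le_mul_of_nonneg_left hρf1 hlam0.le
      _ = (1 - α12) * (lam * ρ12) := by ring
  · calc lam * ρf12 + 2 * (lam * σ12) + α12 * (lam * ρ12) = lam * (ρf12 + 2 * σ12 + α12 * ρ12) := by ring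
      _ ≤ lam * ρ12 := mul_le_mul_of_nonneg_left hρf2 hlam0.le
  · calc lam * ρ13 + 5 * (lam * σ12) = lam * (ρ13 + 5 * σ12) := by ring
      _ ≤ lam * ρ12 := mul_le_mul_of_nonneg_left hρ13ρ hlam0.le
  · have h := mul_le_mul_of_nonneg_left hρ13ρ hlam0.le
    have e : lam * (ρ13 + 5 * σ12) = lam * ρ13 + 5 * (lam * σ12) := by ring
    rw [e] at h; linarith [hσs]
  · calc 3 * (lam * σ12) = lam * (3 * σ12) := by ring
      _ < lam * ((1 - α12) * ρ13) := mul_lt_mul_of_pos_left hσρ13 hlam0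
      _ = (1 - α12) * (lam * ρ13) := by ring

end Summit.QuantumFields.YangMills.BalabanUVNodes.N06ZLettersLegAtPinsPU

end
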